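import Summits.AtomisticToContinuum.BoseEinsteinCondensation.Theorems.BECThomsonPrincipleGDTransferSeededPlainKineticSlots

/-!
# Route `BECThomsonPrinciple`, crux `GDTransfer` (stmt-AtomisticToContinuum-9482), line `seeded-continuity`:
# stub `stub_plainPairAlgebra`, part 2b — the exact kinetic form identity of the PLAIN pair

Support file of the registered stub `stub_plainPairAlgebra`; proves `PlainKineticIdentity` of `…SeededWitnessDefs`:
for periodic `C¹` `f, g`, every `n ∈ ℤ³` and the plain pair `ζ₊ = plainUp = N^{-1/2}B_n`, `ζ₋ = plainDown = N^{-1/2}B_n†`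
(`B_n g = Σ_i e_n(x_i)·P_i g`, `B_n† f = Σ_i P_i^{(n)} f`),
`t(f, ζ₊ g) − t(ζ₋ f, g) = |k|² ⟨f, ζ₊ g⟩`, `|k|² = (2π/L)² Σ_a n_a²`, with the polar kinetic form
`t(f, g) = ∫ Σ_{j,a} conj(∂_{j,a}f) ∂_{j,a}g` (`tform`) — the form version of `[−Δ, B_n] = |k|²B_n` on periodic
functions (`P_iΔ_i = 0`, `[∇_j, P_i] = 0`).  This is VERBATIM the landed identity of the LNSS pair
(`SecondVariation.tform_lnssUpper_sub_tform_lnssLower`) with the inverse root `n̂₀^{-1/2}` removed: slot by slot (part 2a,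
`…SeededPlainKineticSlots`) `⟨∂f, B_n∂g⟩` and `⟨B_n†∂f, ∂g⟩` cancel by adjointness, the slot piece `G_j = e_n(x_j)P_j g`
contributes `−(2πi n_a/L)²⟨f, G_j⟩`, and `Σ_a −(2πi n_a/L)² = (2π/L)²|n|²`; finally the real scalar `N^{-1/2}` is pulled
through the three forms (`tform_upB_sub_tform_dnB` ⇒ `plainKineticIdentity`).
All [folklore] (KennedyLiebShastry1988 (12)–(14); arXiv:1211.2778 §2–3).
-/

noncomputable section

open MeasureTheory Filter
open scoped ENNReal NNReal ComplexConjugate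

namespace Summit.AtomisticToContinuum.BoseEinsteinCondensation.Cruxes.GDTransfer.Seeded

namespace PlainKinetic

open Literature.MathematicalPhysics.QuantumManyBody.BoseGas
open Summit.AtomisticToContinuum.BoseEinsteinCondensation.Theorems.GaussianDominationCan.Negative
open Summit.AtomisticToContinuum.BoseEinsteinCondensation.Cruxes.GDTransfer.DysonDressedWitness
open Lnss SecondVariation

variable {m : ℕ} {L : ℝ}

/-! ## The identity for `B_n`, `B_n†`, and for the plain pair -/

/-- **The exact kinetic form identity of `B_n`, `B_n†`**: for periodic `C¹` `f, g`,
`t(f, B_n g) − t(B_n† f, g) = (2π/L)²|n|² ⟨f, B_n g⟩`. [folklore] -/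
theorem tform_upB_sub_tform_dnB (hL : 0 < L) (n : Fin 3 → ℤ)
    {f g : Config (m + 1) → ℂ} (hf : ContDiff ℝ 1 f)
    (hfp : ∀ (X : Config (m + 1)) (i : Fin (m + 1)) (k : Fin 3),
      f (X + Pi.single i (EuclideanSpace.single k L)) = f X)
    (hg : ContDiff ℝ 1 g)
    (hgp : ∀ (X : Config (m + 1)) (i : Fin (m + 1)) (k : Fin 3),
      g (X + Pi.single i (EuclideanSpace.single k L)) = g X) :
    (∫ X in cellN (m + 1) L, ∑ j : Fin (m + 1), ∑ a : Fin 3,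
        conj (fderiv ℝ f X (Pi.single j (EuclideanSpace.single a 1))) *
          fderiv ℝ (fun Y : Config (m + 1) => ∑ i : Fin (m + 1), cellWave L n (Y i) * cellAvg (m + 1) L i g Y) X
            (Pi.single j (EuclideanSpace.single a 1))) -
      (∫ X in cellN (m + 1) L, ∑ j : Fin (m + 1), ∑ a : Fin 3,
        conj (fderiv ℝ (fun Y => ∑ i : Fin (m + 1), fourierAvg m L n i f Y) X
          (Pi.single j (EuclideanSpace.single a 1))) *
          fderiv ℝ g X (Pi.single j (EuclideanSpace.single a 1))) =
      ((((2 * Real.pi / L) ^ 2 * ∑ a : Fin 3, ((n a : ℝ)) ^ 2 : ℝ)) : ℂ) *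
        ∫ X in cellN (m + 1) L, conj (f X) *
          (∑ i : Fin (m + 1), cellWave L n (X i) * cellAvg (m + 1) L i g X) := by
  -- adapted from `SecondVariation.tform_lnssUpper_sub_tform_lnssLower`
  have hUd : ContDiff ℝ 1 fun Y : Config (m + 1) => ∑ i : Fin (m + 1), cellWave L n (Y i) *
      cellAvg (m + 1) L i g Y := ContDiff.sum fun i _ => contDiff_slot n i hg
  have hLd : ContDiff ℝ 1 fun Y => ∑ i : Fin (m + 1), fourierAvg m L n i f Y :=
    ContDiff.sum fun i _ => contDiff_fourierAvg n i hf
  have hT1 : ∀ (j : Fin (m + 1)) (a : Fin 3), Continuous fun X =>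
      conj (fderiv ℝ f X (Pi.single j (EuclideanSpace.single a 1))) *
        fderiv ℝ (fun Y : Config (m + 1) => ∑ i : Fin (m + 1), cellWave L n (Y i) * cellAvg (m + 1) L i g Y) X
          (Pi.single j (EuclideanSpace.single a 1)) := fun j a =>
    (Complex.continuous_conj.comp (continuous_fderiv_apply_const hf _)).mul
      (continuous_fderiv_apply_const hUd _)
  have hT2 : ∀ (j : Fin (m + 1)) (a : Fin 3), Continuous fun X =>
      conj (fderiv ℝ (fun Y => ∑ i : Fin (m + 1), fourierAvg m L n i f Y) X
        (Pi.single j (EuclideanSpace.single a 1))) *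
        fderiv ℝ g X (Pi.single j (EuclideanSpace.single a 1)) := fun j a =>
    (Complex.continuous_conj.comp (continuous_fderiv_apply_const hLd _)).mul
      (continuous_fderiv_apply_const hg _)
  -- `∫ Σ Σ = Σ Σ ∫`
  have e1 : (∫ X in cellN (m + 1) L, ∑ j : Fin (m + 1), ∑ a : Fin 3,
      conj (fderiv ℝ f X (Pi.single j (EuclideanSpace.single a 1))) *
        fderiv ℝ (fun Y : Config (m + 1) => ∑ i : Fin (m + 1), cellWave L n (Y i) * cellAvg (m + 1) L i g Y) X
          (Pi.single j (EuclideanSpace.single a 1))) =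
      ∑ j : Fin (m + 1), ∑ a : Fin 3,
      ∫ X in cellN (m + 1) L, conj (fderiv ℝ f X (Pi.single j (EuclideanSpace.single a 1))) *
        fderiv ℝ (fun Y : Config (m + 1) => ∑ i : Fin (m + 1), cellWave L n (Y i) * cellAvg (m + 1) L i g Y) X
          (Pi.single j (EuclideanSpace.single a 1)) := by
    rw [integral_finsetSum _ fun j _ => integrable_finsetSum _ fun a _ =>
      integrableOn_cellN (hT1 j a) L]
    exact Finset.sum_congr rfl fun j _ =>
      integral_finsetSum _ fun a _ => integrableOn_cellN (hT1 j a) L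
  have e2 : (∫ X in cellN (m + 1) L, ∑ j : Fin (m + 1), ∑ a : Fin 3,
      conj (fderiv ℝ (fun Y => ∑ i : Fin (m + 1), fourierAvg m L n i f Y) X
        (Pi.single j (EuclideanSpace.single a 1))) *
        fderiv ℝ g X (Pi.single j (EuclideanSpace.single a 1))) =
      ∑ j : Fin (m + 1), ∑ a : Fin 3,
      ∫ X in cellN (m + 1) L,
        conj (fderiv ℝ (fun Y => ∑ i : Fin (m + 1), fourierAvg m L n i f Y) X
          (Pi.single j (EuclideanSpace.single a 1))) *
          fderiv ℝ g X (Pi.single j (EuclideanSpace.single a 1)) := by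
    rw [integral_finsetSum _ fun j _ => integrable_finsetSum _ fun a _ =>
      integrableOn_cellN (hT2 j a) L]
    exact Finset.sum_congr rfl fun j _ =>
      integral_finsetSum _ fun a _ => integrableOn_cellN (hT2 j a) L
  -- `Σ_j ⟨f, G_j⟩ = ⟨f, B_n g⟩`
  have hint : ∀ j ∈ (Finset.univ : Finset (Fin (m + 1))), Integrable
      (fun X => conj (f X) * (cellWave L n (X j) * cellAvg (m + 1) L j g X))
      ((volume : Measure (Config (m + 1))).restrict (cellN (m + 1) L)) := fun j _ =>
    integrableOn_cellN ((Complex.continuous_conj.comp hf.continuous).mul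
      (((continuous_cellWave L n).comp (continuous_apply j)).mul (continuous_cellAvg j hg.continuous))) L
  have e3 : ∑ j : Fin (m + 1), ∫ X in cellN (m + 1) L, conj (f X) *
      (cellWave L n (X j) * cellAvg (m + 1) L j g X) =
        ∫ X in cellN (m + 1) L, conj (f X) *
          (∑ i : Fin (m + 1), cellWave L n (X i) * cellAvg (m + 1) L i g X) := by
    rw [← integral_finsetSum _ hint]
    refine integral_congr_ae (Eventually.of_forall fun X => ?_)
    simp only [Finset.mul_sum]
  rw [e1, e2, ← Finset.sum_sub_distrib, ← e3, Finset.mul_sum]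
  refine Finset.sum_congr rfl fun j _ => ?_
  rw [← Finset.sum_sub_distrib, ← sum_waveCoeff_sq, Finset.sum_mul]
  refine Finset.sum_congr rfl fun a _ => ?_
  rw [tform_slot_upB hL n j a hf hfp hg hgp, tform_slot_dnB hL n j a hf hfp hg hgp]
  ring

/-- The directional derivative of `ζ₊ = N^{-1/2} B_n g` is `N^{-1/2}` times that of `B_n g`. [folklore] -/
theorem fderiv_plainUp_apply (n : Fin 3 → ℤ) {g : Config (m + 1) → ℂ} (hg : ContDiff ℝ 1 g)
    (X v : Config (m + 1)) :
    fderiv ℝ (plainUp m L n g) X v = ((Real.sqrt ((m + 1 : ℕ) : ℝ))⁻¹ : ℂ) *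
      fderiv ℝ (fun Y : Config (m + 1) => ∑ i : Fin (m + 1), cellWave L n (Y i) * cellAvg (m + 1) L i g Y) X v := by
  have hd : DifferentiableAt ℝ (fun Y : Config (m + 1) => ∑ i : Fin (m + 1), cellWave L n (Y i) *
      cellAvg (m + 1) L i g Y) X :=
    (ContDiff.sum fun i _ => contDiff_slot (L := L) n i hg).differentiable one_ne_zero X
  unfold plainUp
  exact fderiv_const_mul_apply' hd _ v

/-- The directional derivative of `ζ₋ = N^{-1/2} B_n† f` is `N^{-1/2}` times that of `B_n† f`. [folklore] -/
theorem fderiv_plainDown_apply (n : Fin 3 → ℤ) {f : Config (m + 1) → ℂ} (hf : ContDiff ℝ 1 f)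
    (X v : Config (m + 1)) :
    fderiv ℝ (plainDown m L n f) X v = ((Real.sqrt ((m + 1 : ℕ) : ℝ))⁻¹ : ℂ) *
      fderiv ℝ (fun Y => ∑ i : Fin (m + 1), fourierAvg m L n i f Y) X v := by
  have hd : DifferentiableAt ℝ (fun Y => ∑ i : Fin (m + 1), fourierAvg m L n i f Y) X :=
    (ContDiff.sum fun i _ => contDiff_fourierAvg (L := L) n i hf).differentiable one_ne_zero X
  unfold plainDown
  exact fderiv_const_mul_apply' hd _ v

end PlainKinetic

open Literature.MathematicalPhysics.QuantumManyBody.BoseGas in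
open Summit.AtomisticToContinuum.BoseEinsteinCondensation.Theorems.GaussianDominationCan.Negative in
open Summit.AtomisticToContinuum.BoseEinsteinCondensation.Cruxes.GDTransfer.DysonDressedWitness in
/-- **Part 2 of `stub_plainPairAlgebra` (registered helper statement)**: the EXACT KINETIC FORM IDENTITY of the plain
pair, `t(f, ζ₊ g) − t(ζ₋ f, g) = (2π/L)²|n|² ⟨f, ζ₊ g⟩` for periodic `C¹` `f, g` (`ζ₊ = plainUp`, `ζ₋ = plainDown`;
form-level `[−Δ, B_n] = |k|²B_n`). [folklore] (KennedyLiebShastry1988 (12)–(14); arXiv:1211.2778 §2–3) -/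
theorem plainKineticIdentity :
    Summit.AtomisticToContinuum.BoseEinsteinCondensation.Cruxes.GDTransfer.Seeded.PlainKineticIdentity := by
  intro m L hL n f g hf hfp hg hgp
  set c : ℂ := ((Real.sqrt ((m + 1 : ℕ) : ℝ))⁻¹ : ℂ) with hc
  have key := PlainKinetic.tform_upB_sub_tform_dnB hL n hf hfp hg hgp
  -- pull the scalar `N^{-1/2}` through the three forms
  have e1 : tform m L f (plainUp m L n g) = c * ∫ X in cellN (m + 1) L, ∑ j : Fin (m + 1), ∑ a : Fin 3,
      conj (fderiv ℝ f X (Pi.single j (EuclideanSpace.single a 1))) *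
        fderiv ℝ (fun Y : Config (m + 1) => ∑ i : Fin (m + 1), cellWave L n (Y i) * cellAvg (m + 1) L i g Y) X
          (Pi.single j (EuclideanSpace.single a 1)) := by
    unfold tform
    rw [← integral_const_mul]
    refine integral_congr_ae (Eventually.of_forall fun X => ?_)
    simp only [PlainKinetic.fderiv_plainUp_apply n hg, Finset.mul_sum]
    exact Finset.sum_congr rfl fun j _ => Finset.sum_congr rfl fun a _ => by ring
  have e2 : tform m L (plainDown m L n f) g = c * ∫ X in cellN (m + 1) L, ∑ j : Fin (m + 1), ∑ a : Fin 3,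
      conj (fderiv ℝ (fun Y => ∑ i : Fin (m + 1), fourierAvg m L n i f Y) X
        (Pi.single j (EuclideanSpace.single a 1))) *
        fderiv ℝ g X (Pi.single j (EuclideanSpace.single a 1)) := by
    unfold tform
    rw [← integral_const_mul]
    refine integral_congr_ae (Eventually.of_forall fun X => ?_)
    simp only [PlainKinetic.fderiv_plainDown_apply n hf, Finset.mul_sum, map_mul, hc, map_inv₀,
      Complex.conj_ofReal]
    exact Finset.sum_congr rfl fun j _ => Finset.sum_congr rfl fun a _ => by ring
  have e3 : (∫ X in cellN (m + 1) L, conj (f X) * plainUp m L n g X) =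
      c * ∫ X in cellN (m + 1) L, conj (f X) *
        (∑ i : Fin (m + 1), cellWave L n (X i) * cellAvg (m + 1) L i g X) := by
    unfold plainUp
    rw [← integral_const_mul]
    exact integral_congr_ae (Eventually.of_forall fun X => by simp only; ring)
  rw [e1, e2, e3, ← mul_sub, key]
  ring

end Summit.AtomisticToContinuum.BoseEinsteinCondensation.Cruxes.GDTransfer.Seeded

end
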